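import Summits.HodgeConjecture.HodgeConjecture.Theorems.Ring2WeilCoverageCMFieldRationalClassesFibres
import Summits.HodgeConjecture.HodgeConjecture.Theorems.Ring2WeilCoverageCMFieldRationalPrimeRule
import HarnessLib

/-!
# Ring 2 — Weil-family coverage, CM-field rows: RATIONAL classes are constant on the fibres of `Spec 𝓞_F → Spec ℤ`,
  instances I: the five quartic CM subfields of `ℚ(ζ₄₈)` outside the census (`ℚ(i,√6)`, `ℚ(√-2,√3)`, `ℚ(√-3,√2)`, `ℚ(√-2,√-3)`, `ℚ(√-3(2+√2))`) (WEIL-FAMILY-COVERAGE «## b03», cell (xxi′)(a), part 34)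

research route conditional on HC_CM; not a corollary; Q11.4-sentence-2 already refuted in dim ≥ 3.

For each quartic CM field `E` below, over its Deligne carrier `R = S² + pS + q` (`F = ℚ[S]/(R)`, `E = F(√θ)`; explicit `hR` in
every signature) [cite: Deligne1982HodgeCycles, §4 p. 30, (1), Cor. 4.2], part 33's table theorems are instantiated:
* `KEY_inl_mem_badPlaces_ratCast_iff` — **for every `c ∈ ℚ^×` and every odd prime `ℓ` (`ℓ ∤ b₀`, resp. `ℓ ∤ q`), `T(c)`
  contains BOTH places of `F` over `ℓ` or NONE** (biquadratic `E = F(√b₀)`: `θ = c₁²·b₀` written out and checked by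
  `linear_combination`; cyclic `E`: `q = s₀²` with `s₀ ∈ ℤ[θ]` written out);
* `KEY_badPlaces_ratCast_ne_pair` — **row form: `T(c) ≠ {v, w}` whenever `v ≠ v'` lie over such an `ℓ` and `w ≠ v'`**: a
  `|T| = 2` row of the table `W_{2k}.E.T` through ONE place of a split prime has no rational member — the «–» entries of
  §b03.5 / §b03.29 (2), for every rational number and every such row at once;
* where `F` has an odd ramified prime `ℓ₀ ∤ b₀`: `KEY_inl_notMem_badPlaces_ratCast_of_mem_…` — **the place over `ℓ₀` lies
  in NO `T(c)`** (`π = 2θ + p`, `π² = disc R = ℓ₀·w`, `(ℓ₀, w) = 1`, `e = 2`), with its row form `T(c) ≠ {v, w}` for all `w`.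
* §90 `ℚ(i,√6)` (`R = S² + 14S + 25`; `b₀ = -1`; ramified prime(s) 3).
* §91 `ℚ(√-2,√3)` (`R = S² + 16S + 16`; `b₀ = -2`; ramified prime(s) 3).
* §92 `ℚ(√-3,√2)` (`R = S² + 18S + 9`; `b₀ = -3`).
* §93 `ℚ(√-2,√-3)` (`R = S² + 10S + 1`; `b₀ = -2`; ramified prime(s) 3).
* §94 `ℚ(√-3(2+√2))` (`R = S² + 12S + 18`; cyclic, `q = 18`).

No new definition, no named fact, no sorry; nothing about the Hodge conjecture is asserted.
-/

noncomputable section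

set_option linter.dupNamespace false

open Polynomial NumberField IsDedekindDomain

namespace Summit.HodgeConjecture.HodgeConjecture.Ring2.WeilCoverageCM

open Literature.AlgebraicGeometry.Deligne1982
open Literature.AlgebraicGeometry.HodgeTheory (splitDiscriminantClassCM)
open Literature.NumberTheory.QuadraticForms

variable {R : Polynomial ℤ} [Fact (Irreducible (cmPolyQ R))] [Fact (Irreducible (realPolyQ R))]

/-! ### §90 `E = ℚ(i,√6)` (`R = S² + 14S + 25`, `F = ℚ(√6)`, `E = F(√-1)`) -/
section IsqrtNeg1Sqrt6

omit [Fact (Irreducible (cmPolyQ R))] in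
/-- `ℚ(i,√6)` (`R = S² + 14S + 25`): **`θ = c₁²·(-1)`** with `c₁ = -5/2 + (-1/2)·θ` — `E = F(√-1)`, `F = ℚ(√6)`.
[cite: Deligne1982HodgeCycles, §4 p. 30] -/
theorem sqrtNeg1Sqrt6_root_eq_sq_mul_neg_one (hR : R = X ^ 2 + C 14 * X + C 25) :
    AdjoinRoot.root (realPolyQ R) = ((-5/2 : realField R) + (-1/2 : realField R) * AdjoinRoot.root (realPolyQ R)) ^ 2
      * (((-(1 : ℕ) : ℤ) : 𝓞 (realField R)) : realField R) := by
  have hrel := root_rel_quadratic hR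
  push_cast at hrel
  rw [show (((-(1 : ℕ) : ℤ) : 𝓞 (realField R)) : realField R) = ((-(1 : ℕ) : ℤ) : realField R) from
    map_intCast (algebraMap (𝓞 (realField R)) (realField R)) _]
  push_cast
  linear_combination (1/4 : realField R) * hrel

/-- **`ℚ(i,√6)`: for EVERY `c ∈ ℚ^×` and every odd prime `ℓ`, `T(c)` contains BOTH places of `F = ℚ(√6)` over `ℓ`
or NONE** — the rational classes of the table `W_{2k}.E.T` are constant on the fibres of `Spec 𝓞_F → Spec ℤ`.
[cite: Deligne1982HodgeCycles, §4 (1)] [cite: Omeara1963, §63B Cor. 63:11a and Example 63:12] -/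
theorem sqrtNeg1Sqrt6_inl_mem_badPlaces_ratCast_iff (hR : R = X ^ 2 + C 14 * X + C 25) {ℓ : ℕ} (hℓ : ℓ.Prime)
    (hℓ2 : ℓ ≠ 2) (v v' : HeightOneSpectrum (𝓞 (realField R)))
    (hv : (ℓ : 𝓞 (realField R)) ∈ v.asIdeal) (hv' : (ℓ : 𝓞 (realField R)) ∈ v'.asIdeal) {c : ℚ} (hc : c ≠ 0) :
    Sum.inl v ∈ badPlaces (c : realField R) (AdjoinRoot.root (realPolyQ R)) ↔
      Sum.inl v' ∈ badPlaces (c : realField R) (AdjoinRoot.root (realPolyQ R)) :=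
  inl_mem_badPlaces_ratCast_iff_of_intCast_radicand hR (sqrtNeg1Sqrt6_root_eq_sq_mul_neg_one hR) hℓ hℓ2
    (not_natCast_dvd_neg_natCast hℓ (Or.inl rfl) hℓ.one_lt.ne') v v' hv hv' hc

/-- **`ℚ(i,√6)`, row form: a `|T| = 2` row `{v, w}` with `v ≠ v'` the two places over an odd prime `ℓ` and
`w ≠ v'` has NO RATIONAL MEMBER**: `T(c) ≠ {v, w}` for every `c ∈ ℚ^×` (the «least rational n: –» rows, for every `n`).
[cite: Deligne1982HodgeCycles, §4 (1) and Cor. 4.2] -/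
theorem sqrtNeg1Sqrt6_badPlaces_ratCast_ne_pair (hR : R = X ^ 2 + C 14 * X + C 25) {ℓ : ℕ} (hℓ : ℓ.Prime)
    (hℓ2 : ℓ ≠ 2) (v v' w : HeightOneSpectrum (𝓞 (realField R)))
    (hv : (ℓ : 𝓞 (realField R)) ∈ v.asIdeal) (hv' : (ℓ : 𝓞 (realField R)) ∈ v'.asIdeal) (hne : v ≠ v') (hw : w ≠ v')
    {c : ℚ} (hc : c ≠ 0) :
    badPlaces (c : realField R) (AdjoinRoot.root (realPolyQ R)) ≠ {Sum.inl v, Sum.inl w} :=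
  badPlaces_ratCast_ne_pair_of_intCast_radicand hR (sqrtNeg1Sqrt6_root_eq_sq_mul_neg_one hR) hℓ hℓ2
    (not_natCast_dvd_neg_natCast hℓ (Or.inl rfl) hℓ.one_lt.ne') v v' w hv hv' hne hw hc

/-- **`ℚ(i,√6)`: the place of `F = ℚ(√6)` over the RAMIFIED prime `3` (inert in `E`) lies in NO `T(c)`, `c ∈ ℚ^×`**
(`π = 2θ + 14`, `π² = 96 = 3·32`, `(11)·3 + (-1)·32 = 1`: `(3, π)² = (3)`, `e = 2`, `ord_v c` even).
[cite: Omeara1963, §63B Cor. 63:11a and Example 63:12] [cite: Deligne1982HodgeCycles, §4 (1)] -/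
theorem sqrtNeg1Sqrt6_inl_notMem_badPlaces_ratCast_of_mem_three (hR : R = X ^ 2 + C 14 * X + C 25)
    (v : HeightOneSpectrum (𝓞 (realField R))) (hv : (3 : 𝓞 (realField R)) ∈ v.asIdeal) {c : ℚ} (hc : c ≠ 0) :
    Sum.inl v ∉ badPlaces (c : realField R) (AdjoinRoot.root (realPolyQ R)) := by
  obtain ⟨hRm, -⟩ := monic_and_natDegree_of_quadratic R hR
  obtain ⟨θₒ, hθ⟩ := exists_ringOfIntegers_coe_eq_root hRm
  have hrel := ringOfIntegers_root_rel_quadratic hR hθ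
  push_cast at hrel
  have hπ : (2 * θₒ + 14) ^ 2 = ((3 : ℕ) : 𝓞 (realField R)) * 32 := by
    push_cast
    linear_combination (4 : 𝓞 (realField R)) * hrel
  have hv' : ((3 : ℕ) : 𝓞 (realField R)) ∈ v.asIdeal := by exact_mod_cast hv
  have hb : (((-(1 : ℕ) : ℤ)) : 𝓞 (realField R)) ∉ v.asIdeal :=
    (intCast_mem_iff_natCast_dvd Nat.prime_three v hv' _).not.2
      (not_natCast_dvd_neg_natCast Nat.prime_three (Or.inl rfl) (by norm_num))
  exact inl_notMem_badPlaces_ratCast_of_sq_eq_mul hR (sqrtNeg1Sqrt6_root_eq_sq_mul_neg_one hR) Nat.prime_three (by norm_num) hπ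
    (a := 11) (b := -1) (by push_cast; ring) v hv' hb hc

/-- **`ℚ(i,√6)`, row form at the ramified prime `3`**: `T(c) ≠ {v, w}` for the place `v ∋ 3`, every place `w` and
every `c ∈ ℚ^×`. [cite: Deligne1982HodgeCycles, §4 (1) and Cor. 4.2] -/
theorem sqrtNeg1Sqrt6_badPlaces_ratCast_ne_pair_of_mem_three (hR : R = X ^ 2 + C 14 * X + C 25)
    (v w : HeightOneSpectrum (𝓞 (realField R))) (hv : (3 : 𝓞 (realField R)) ∈ v.asIdeal) {c : ℚ} (hc : c ≠ 0) :
    badPlaces (c : realField R) (AdjoinRoot.root (realPolyQ R)) ≠ {Sum.inl v, Sum.inl w} := by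
  intro h
  have h1 : Sum.inl v ∈ badPlaces (c : realField R) (AdjoinRoot.root (realPolyQ R)) := by
    rw [h]; exact Set.mem_insert _ _
  exact sqrtNeg1Sqrt6_inl_notMem_badPlaces_ratCast_of_mem_three hR v hv hc h1

end IsqrtNeg1Sqrt6

/-! ### §91 `E = ℚ(√-2,√3)` (`R = S² + 16S + 16`, `F = ℚ(√3)`, `E = F(√-2)`) -/
section IsqrtNeg2Sqrt3

omit [Fact (Irreducible (cmPolyQ R))] in
/-- `ℚ(√-2,√3)` (`R = S² + 16S + 16`): **`θ = c₁²·(-2)`** with `c₁ = -1 + (-1/4)·θ` — `E = F(√-2)`, `F = ℚ(√3)`.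
[cite: Deligne1982HodgeCycles, §4 p. 30] -/
theorem sqrtNeg2Sqrt3_root_eq_sq_mul_neg_two (hR : R = X ^ 2 + C 16 * X + C 16) :
    AdjoinRoot.root (realPolyQ R) = ((-1 : realField R) + (-1/4 : realField R) * AdjoinRoot.root (realPolyQ R)) ^ 2
      * (((-(2 : ℕ) : ℤ) : 𝓞 (realField R)) : realField R) := by
  have hrel := root_rel_quadratic hR
  push_cast at hrel
  rw [show (((-(2 : ℕ) : ℤ) : 𝓞 (realField R)) : realField R) = ((-(2 : ℕ) : ℤ) : realField R) from
    map_intCast (algebraMap (𝓞 (realField R)) (realField R)) _]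
  push_cast
  linear_combination (1/8 : realField R) * hrel

/-- **`ℚ(√-2,√3)`: for EVERY `c ∈ ℚ^×` and every odd prime `ℓ`, `T(c)` contains BOTH places of `F = ℚ(√3)` over `ℓ`
or NONE** — the rational classes of the table `W_{2k}.E.T` are constant on the fibres of `Spec 𝓞_F → Spec ℤ`.
[cite: Deligne1982HodgeCycles, §4 (1)] [cite: Omeara1963, §63B Cor. 63:11a and Example 63:12] -/
theorem sqrtNeg2Sqrt3_inl_mem_badPlaces_ratCast_iff (hR : R = X ^ 2 + C 16 * X + C 16) {ℓ : ℕ} (hℓ : ℓ.Prime)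
    (hℓ2 : ℓ ≠ 2) (v v' : HeightOneSpectrum (𝓞 (realField R)))
    (hv : (ℓ : 𝓞 (realField R)) ∈ v.asIdeal) (hv' : (ℓ : 𝓞 (realField R)) ∈ v'.asIdeal) {c : ℚ} (hc : c ≠ 0) :
    Sum.inl v ∈ badPlaces (c : realField R) (AdjoinRoot.root (realPolyQ R)) ↔
      Sum.inl v' ∈ badPlaces (c : realField R) (AdjoinRoot.root (realPolyQ R)) :=
  inl_mem_badPlaces_ratCast_iff_of_intCast_radicand hR (sqrtNeg2Sqrt3_root_eq_sq_mul_neg_two hR) hℓ hℓ2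
    (not_natCast_dvd_neg_natCast hℓ (Or.inr Nat.prime_two) hℓ2) v v' hv hv' hc

/-- **`ℚ(√-2,√3)`, row form: a `|T| = 2` row `{v, w}` with `v ≠ v'` the two places over an odd prime `ℓ` and
`w ≠ v'` has NO RATIONAL MEMBER**: `T(c) ≠ {v, w}` for every `c ∈ ℚ^×` (the «least rational n: –» rows, for every `n`).
[cite: Deligne1982HodgeCycles, §4 (1) and Cor. 4.2] -/
theorem sqrtNeg2Sqrt3_badPlaces_ratCast_ne_pair (hR : R = X ^ 2 + C 16 * X + C 16) {ℓ : ℕ} (hℓ : ℓ.Prime)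
    (hℓ2 : ℓ ≠ 2) (v v' w : HeightOneSpectrum (𝓞 (realField R)))
    (hv : (ℓ : 𝓞 (realField R)) ∈ v.asIdeal) (hv' : (ℓ : 𝓞 (realField R)) ∈ v'.asIdeal) (hne : v ≠ v') (hw : w ≠ v')
    {c : ℚ} (hc : c ≠ 0) :
    badPlaces (c : realField R) (AdjoinRoot.root (realPolyQ R)) ≠ {Sum.inl v, Sum.inl w} :=
  badPlaces_ratCast_ne_pair_of_intCast_radicand hR (sqrtNeg2Sqrt3_root_eq_sq_mul_neg_two hR) hℓ hℓ2
    (not_natCast_dvd_neg_natCast hℓ (Or.inr Nat.prime_two) hℓ2) v v' w hv hv' hne hw hc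

/-- **`ℚ(√-2,√3)`: the place of `F = ℚ(√3)` over the RAMIFIED prime `3` (inert in `E`) lies in NO `T(c)`, `c ∈ ℚ^×`**
(`π = 2θ + 16`, `π² = 192 = 3·64`, `(-21)·3 + (1)·64 = 1`: `(3, π)² = (3)`, `e = 2`, `ord_v c` even).
[cite: Omeara1963, §63B Cor. 63:11a and Example 63:12] [cite: Deligne1982HodgeCycles, §4 (1)] -/
theorem sqrtNeg2Sqrt3_inl_notMem_badPlaces_ratCast_of_mem_three (hR : R = X ^ 2 + C 16 * X + C 16)
    (v : HeightOneSpectrum (𝓞 (realField R))) (hv : (3 : 𝓞 (realField R)) ∈ v.asIdeal) {c : ℚ} (hc : c ≠ 0) :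
    Sum.inl v ∉ badPlaces (c : realField R) (AdjoinRoot.root (realPolyQ R)) := by
  obtain ⟨hRm, -⟩ := monic_and_natDegree_of_quadratic R hR
  obtain ⟨θₒ, hθ⟩ := exists_ringOfIntegers_coe_eq_root hRm
  have hrel := ringOfIntegers_root_rel_quadratic hR hθ
  push_cast at hrel
  have hπ : (2 * θₒ + 16) ^ 2 = ((3 : ℕ) : 𝓞 (realField R)) * 64 := by
    push_cast
    linear_combination (4 : 𝓞 (realField R)) * hrel
  have hv' : ((3 : ℕ) : 𝓞 (realField R)) ∈ v.asIdeal := by exact_mod_cast hv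
  have hb : (((-(2 : ℕ) : ℤ)) : 𝓞 (realField R)) ∉ v.asIdeal :=
    (intCast_mem_iff_natCast_dvd Nat.prime_three v hv' _).not.2
      (not_natCast_dvd_neg_natCast Nat.prime_three (Or.inr Nat.prime_two) (by norm_num))
  exact inl_notMem_badPlaces_ratCast_of_sq_eq_mul hR (sqrtNeg2Sqrt3_root_eq_sq_mul_neg_two hR) Nat.prime_three (by norm_num) hπ
    (a := -21) (b := 1) (by push_cast; ring) v hv' hb hc

/-- **`ℚ(√-2,√3)`, row form at the ramified prime `3`**: `T(c) ≠ {v, w}` for the place `v ∋ 3`, every place `w` and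
every `c ∈ ℚ^×`. [cite: Deligne1982HodgeCycles, §4 (1) and Cor. 4.2] -/
theorem sqrtNeg2Sqrt3_badPlaces_ratCast_ne_pair_of_mem_three (hR : R = X ^ 2 + C 16 * X + C 16)
    (v w : HeightOneSpectrum (𝓞 (realField R))) (hv : (3 : 𝓞 (realField R)) ∈ v.asIdeal) {c : ℚ} (hc : c ≠ 0) :
    badPlaces (c : realField R) (AdjoinRoot.root (realPolyQ R)) ≠ {Sum.inl v, Sum.inl w} := by
  intro h
  have h1 : Sum.inl v ∈ badPlaces (c : realField R) (AdjoinRoot.root (realPolyQ R)) := by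
    rw [h]; exact Set.mem_insert _ _
  exact sqrtNeg2Sqrt3_inl_notMem_badPlaces_ratCast_of_mem_three hR v hv hc h1

end IsqrtNeg2Sqrt3

/-! ### §92 `E = ℚ(√-3,√2)` (`R = S² + 18S + 9`, `F = ℚ(√2)`, `E = F(√-3)`) -/
section IsqrtNeg3Sqrt2

omit [Fact (Irreducible (cmPolyQ R))] in
/-- `ℚ(√-3,√2)` (`R = S² + 18S + 9`): **`θ = c₁²·(-3)`** with `c₁ = -1/2 + (-1/6)·θ` — `E = F(√-3)`, `F = ℚ(√2)`.
[cite: Deligne1982HodgeCycles, §4 p. 30] -/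
theorem sqrtNeg3Sqrt2_root_eq_sq_mul_neg_three (hR : R = X ^ 2 + C 18 * X + C 9) :
    AdjoinRoot.root (realPolyQ R) = ((-1/2 : realField R) + (-1/6 : realField R) * AdjoinRoot.root (realPolyQ R)) ^ 2
      * (((-(3 : ℕ) : ℤ) : 𝓞 (realField R)) : realField R) := by
  have hrel := root_rel_quadratic hR
  push_cast at hrel
  rw [show (((-(3 : ℕ) : ℤ) : 𝓞 (realField R)) : realField R) = ((-(3 : ℕ) : ℤ) : realField R) from
    map_intCast (algebraMap (𝓞 (realField R)) (realField R)) _]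
  push_cast
  linear_combination (1/12 : realField R) * hrel

/-- **`ℚ(√-3,√2)`: for EVERY `c ∈ ℚ^×` and every odd prime `ℓ`, `ℓ ≠ 3`, `T(c)` contains BOTH places of `F = ℚ(√2)` over `ℓ`
or NONE** — the rational classes of the table `W_{2k}.E.T` are constant on the fibres of `Spec 𝓞_F → Spec ℤ`.
[cite: Deligne1982HodgeCycles, §4 (1)] [cite: Omeara1963, §63B Cor. 63:11a and Example 63:12] -/
theorem sqrtNeg3Sqrt2_inl_mem_badPlaces_ratCast_iff (hR : R = X ^ 2 + C 18 * X + C 9) {ℓ : ℕ} (hℓ : ℓ.Prime)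
    (hℓ2 : ℓ ≠ 2) (hℓ3 : ℓ ≠ 3) (v v' : HeightOneSpectrum (𝓞 (realField R)))
    (hv : (ℓ : 𝓞 (realField R)) ∈ v.asIdeal) (hv' : (ℓ : 𝓞 (realField R)) ∈ v'.asIdeal) {c : ℚ} (hc : c ≠ 0) :
    Sum.inl v ∈ badPlaces (c : realField R) (AdjoinRoot.root (realPolyQ R)) ↔
      Sum.inl v' ∈ badPlaces (c : realField R) (AdjoinRoot.root (realPolyQ R)) :=
  inl_mem_badPlaces_ratCast_iff_of_intCast_radicand hR (sqrtNeg3Sqrt2_root_eq_sq_mul_neg_three hR) hℓ hℓ2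
    (not_natCast_dvd_neg_natCast hℓ (Or.inr Nat.prime_three) hℓ3) v v' hv hv' hc

/-- **`ℚ(√-3,√2)`, row form: a `|T| = 2` row `{v, w}` with `v ≠ v'` the two places over an odd prime `ℓ`, `ℓ ≠ 3` and
`w ≠ v'` has NO RATIONAL MEMBER**: `T(c) ≠ {v, w}` for every `c ∈ ℚ^×` (the «least rational n: –» rows, for every `n`).
[cite: Deligne1982HodgeCycles, §4 (1) and Cor. 4.2] -/
theorem sqrtNeg3Sqrt2_badPlaces_ratCast_ne_pair (hR : R = X ^ 2 + C 18 * X + C 9) {ℓ : ℕ} (hℓ : ℓ.Prime)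
    (hℓ2 : ℓ ≠ 2) (hℓ3 : ℓ ≠ 3) (v v' w : HeightOneSpectrum (𝓞 (realField R)))
    (hv : (ℓ : 𝓞 (realField R)) ∈ v.asIdeal) (hv' : (ℓ : 𝓞 (realField R)) ∈ v'.asIdeal) (hne : v ≠ v') (hw : w ≠ v')
    {c : ℚ} (hc : c ≠ 0) :
    badPlaces (c : realField R) (AdjoinRoot.root (realPolyQ R)) ≠ {Sum.inl v, Sum.inl w} :=
  badPlaces_ratCast_ne_pair_of_intCast_radicand hR (sqrtNeg3Sqrt2_root_eq_sq_mul_neg_three hR) hℓ hℓ2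
    (not_natCast_dvd_neg_natCast hℓ (Or.inr Nat.prime_three) hℓ3) v v' w hv hv' hne hw hc

end IsqrtNeg3Sqrt2

/-! ### §93 `E = ℚ(√-2,√-3)` (`R = S² + 10S + 1`, `F = ℚ(√6)`, `E = F(√-2)`) -/
section IsqrtNeg2SqrtNeg3

omit [Fact (Irreducible (cmPolyQ R))] in
/-- `ℚ(√-2,√-3)` (`R = S² + 10S + 1`): **`θ = c₁²·(-2)`** with `c₁ = -1/4 + (-1/4)·θ` — `E = F(√-2)`, `F = ℚ(√6)`.
[cite: Deligne1982HodgeCycles, §4 p. 30] -/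
theorem sqrtNeg2SqrtNeg3_root_eq_sq_mul_neg_two (hR : R = X ^ 2 + C 10 * X + C 1) :
    AdjoinRoot.root (realPolyQ R) = ((-1/4 : realField R) + (-1/4 : realField R) * AdjoinRoot.root (realPolyQ R)) ^ 2
      * (((-(2 : ℕ) : ℤ) : 𝓞 (realField R)) : realField R) := by
  have hrel := root_rel_quadratic hR
  push_cast at hrel
  rw [show (((-(2 : ℕ) : ℤ) : 𝓞 (realField R)) : realField R) = ((-(2 : ℕ) : ℤ) : realField R) from
    map_intCast (algebraMap (𝓞 (realField R)) (realField R)) _]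
  push_cast
  linear_combination (1/8 : realField R) * hrel

/-- **`ℚ(√-2,√-3)`: for EVERY `c ∈ ℚ^×` and every odd prime `ℓ`, `T(c)` contains BOTH places of `F = ℚ(√6)` over `ℓ`
or NONE** — the rational classes of the table `W_{2k}.E.T` are constant on the fibres of `Spec 𝓞_F → Spec ℤ`.
[cite: Deligne1982HodgeCycles, §4 (1)] [cite: Omeara1963, §63B Cor. 63:11a and Example 63:12] -/
theorem sqrtNeg2SqrtNeg3_inl_mem_badPlaces_ratCast_iff (hR : R = X ^ 2 + C 10 * X + C 1) {ℓ : ℕ} (hℓ : ℓ.Prime)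
    (hℓ2 : ℓ ≠ 2) (v v' : HeightOneSpectrum (𝓞 (realField R)))
    (hv : (ℓ : 𝓞 (realField R)) ∈ v.asIdeal) (hv' : (ℓ : 𝓞 (realField R)) ∈ v'.asIdeal) {c : ℚ} (hc : c ≠ 0) :
    Sum.inl v ∈ badPlaces (c : realField R) (AdjoinRoot.root (realPolyQ R)) ↔
      Sum.inl v' ∈ badPlaces (c : realField R) (AdjoinRoot.root (realPolyQ R)) :=
  inl_mem_badPlaces_ratCast_iff_of_intCast_radicand hR (sqrtNeg2SqrtNeg3_root_eq_sq_mul_neg_two hR) hℓ hℓ2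
    (not_natCast_dvd_neg_natCast hℓ (Or.inr Nat.prime_two) hℓ2) v v' hv hv' hc

/-- **`ℚ(√-2,√-3)`, row form: a `|T| = 2` row `{v, w}` with `v ≠ v'` the two places over an odd prime `ℓ` and
`w ≠ v'` has NO RATIONAL MEMBER**: `T(c) ≠ {v, w}` for every `c ∈ ℚ^×` (the «least rational n: –» rows, for every `n`).
[cite: Deligne1982HodgeCycles, §4 (1) and Cor. 4.2] -/
theorem sqrtNeg2SqrtNeg3_badPlaces_ratCast_ne_pair (hR : R = X ^ 2 + C 10 * X + C 1) {ℓ : ℕ} (hℓ : ℓ.Prime)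
    (hℓ2 : ℓ ≠ 2) (v v' w : HeightOneSpectrum (𝓞 (realField R)))
    (hv : (ℓ : 𝓞 (realField R)) ∈ v.asIdeal) (hv' : (ℓ : 𝓞 (realField R)) ∈ v'.asIdeal) (hne : v ≠ v') (hw : w ≠ v')
    {c : ℚ} (hc : c ≠ 0) :
    badPlaces (c : realField R) (AdjoinRoot.root (realPolyQ R)) ≠ {Sum.inl v, Sum.inl w} :=
  badPlaces_ratCast_ne_pair_of_intCast_radicand hR (sqrtNeg2SqrtNeg3_root_eq_sq_mul_neg_two hR) hℓ hℓ2
    (not_natCast_dvd_neg_natCast hℓ (Or.inr Nat.prime_two) hℓ2) v v' w hv hv' hne hw hc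

/-- **`ℚ(√-2,√-3)`: the place of `F = ℚ(√6)` over the RAMIFIED prime `3` (inert in `E`) lies in NO `T(c)`, `c ∈ ℚ^×`**
(`π = 2θ + 10`, `π² = 96 = 3·32`, `(11)·3 + (-1)·32 = 1`: `(3, π)² = (3)`, `e = 2`, `ord_v c` even).
[cite: Omeara1963, §63B Cor. 63:11a and Example 63:12] [cite: Deligne1982HodgeCycles, §4 (1)] -/
theorem sqrtNeg2SqrtNeg3_inl_notMem_badPlaces_ratCast_of_mem_three (hR : R = X ^ 2 + C 10 * X + C 1)
    (v : HeightOneSpectrum (𝓞 (realField R))) (hv : (3 : 𝓞 (realField R)) ∈ v.asIdeal) {c : ℚ} (hc : c ≠ 0) :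
    Sum.inl v ∉ badPlaces (c : realField R) (AdjoinRoot.root (realPolyQ R)) := by
  obtain ⟨hRm, -⟩ := monic_and_natDegree_of_quadratic R hR
  obtain ⟨θₒ, hθ⟩ := exists_ringOfIntegers_coe_eq_root hRm
  have hrel := ringOfIntegers_root_rel_quadratic hR hθ
  push_cast at hrel
  have hπ : (2 * θₒ + 10) ^ 2 = ((3 : ℕ) : 𝓞 (realField R)) * 32 := by
    push_cast
    linear_combination (4 : 𝓞 (realField R)) * hrel
  have hv' : ((3 : ℕ) : 𝓞 (realField R)) ∈ v.asIdeal := by exact_mod_cast hv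
  have hb : (((-(2 : ℕ) : ℤ)) : 𝓞 (realField R)) ∉ v.asIdeal :=
    (intCast_mem_iff_natCast_dvd Nat.prime_three v hv' _).not.2
      (not_natCast_dvd_neg_natCast Nat.prime_three (Or.inr Nat.prime_two) (by norm_num))
  exact inl_notMem_badPlaces_ratCast_of_sq_eq_mul hR (sqrtNeg2SqrtNeg3_root_eq_sq_mul_neg_two hR) Nat.prime_three (by norm_num) hπ
    (a := 11) (b := -1) (by push_cast; ring) v hv' hb hc

/-- **`ℚ(√-2,√-3)`, row form at the ramified prime `3`**: `T(c) ≠ {v, w}` for the place `v ∋ 3`, every place `w` and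
every `c ∈ ℚ^×`. [cite: Deligne1982HodgeCycles, §4 (1) and Cor. 4.2] -/
theorem sqrtNeg2SqrtNeg3_badPlaces_ratCast_ne_pair_of_mem_three (hR : R = X ^ 2 + C 10 * X + C 1)
    (v w : HeightOneSpectrum (𝓞 (realField R))) (hv : (3 : 𝓞 (realField R)) ∈ v.asIdeal) {c : ℚ} (hc : c ≠ 0) :
    badPlaces (c : realField R) (AdjoinRoot.root (realPolyQ R)) ≠ {Sum.inl v, Sum.inl w} := by
  intro h
  have h1 : Sum.inl v ∈ badPlaces (c : realField R) (AdjoinRoot.root (realPolyQ R)) := by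
    rw [h]; exact Set.mem_insert _ _
  exact sqrtNeg2SqrtNeg3_inl_notMem_badPlaces_ratCast_of_mem_three hR v hv hc h1

end IsqrtNeg2SqrtNeg3

/-! ### §94 `E = ℚ(√-3(2+√2))` (`R = S² + 12S + 18`, `F = ℚ(√2)`, `E/ℚ` cyclic: `q = 18 = s₀²`, `s₀ = θ + 6`) -/
section IsqrtNegThreeTimesTwoPlusSqrtTwo

/-- **`ℚ(√-3(2+√2))` (cyclic): for EVERY `c ∈ ℚ^×` and every odd prime `ℓ`, `ℓ ≠ 3`, `T(c)` contains BOTH places of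
`F = ℚ(√2)` over `ℓ` or NONE** (`q = 18 = (θ + 6)²` in `ℤ[θ]`: the residues of `θ` at the two places over a split `ℓ` are
the two roots of `R̄`, of square product). [cite: Deligne1982HodgeCycles, §4 (1)] [cite: Omeara1963, §63B Cor. 63:11a] -/
theorem sqrtNegThreeTimesTwoPlusSqrtTwo_inl_mem_badPlaces_ratCast_iff (hR : R = X ^ 2 + C 12 * X + C 18) {ℓ : ℕ} (hℓ : ℓ.Prime)
    (hℓ2 : ℓ ≠ 2) (hℓ3 : ℓ ≠ 3) (v v' : HeightOneSpectrum (𝓞 (realField R)))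
    (hv : (ℓ : 𝓞 (realField R)) ∈ v.asIdeal) (hv' : (ℓ : 𝓞 (realField R)) ∈ v'.asIdeal) {c : ℚ} (hc : c ≠ 0) :
    Sum.inl v ∈ badPlaces (c : realField R) (AdjoinRoot.root (realPolyQ R)) ↔
      Sum.inl v' ∈ badPlaces (c : realField R) (AdjoinRoot.root (realPolyQ R)) := by
  obtain ⟨hRm, -⟩ := monic_and_natDegree_of_quadratic R hR
  obtain ⟨θₒ, hθ⟩ := exists_ringOfIntegers_coe_eq_root hRm
  have hrel := ringOfIntegers_root_rel_quadratic hR hθ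
  push_cast at hrel
  have hs : ((6 : 𝓞 (realField R)) + 1 * θₒ) ^ 2 = ((18 : ℤ) : 𝓞 (realField R)) := by
    push_cast
    linear_combination (1 : 𝓞 (realField R)) * hrel
  have hℓq : ¬ (ℓ : ℤ) ∣ 18 := fun h ↦ by
    have h' : ℓ ∣ 2 ^ 1 * 3 ^ 2 * 5 ^ 0 := by norm_num; exact_mod_cast h
    rcases eq_of_prime_dvd_two_pow_mul hℓ h' with rfl | rfl | rfl <;> omega
  exact inl_mem_badPlaces_ratCast_iff_of_sq_eq hR hθ hs hℓ hℓ2 hℓq v v' hv hv' hc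

/-- **`ℚ(√-3(2+√2))`, row form: a `|T| = 2` row `{v, w}` with `v ≠ v'` the two places over an odd prime `ℓ`, `ℓ ≠ 3`
and `w ≠ v'` has NO RATIONAL MEMBER**: `T(c) ≠ {v, w}` for every `c ∈ ℚ^×`.
[cite: Deligne1982HodgeCycles, §4 (1) and Cor. 4.2] -/
theorem sqrtNegThreeTimesTwoPlusSqrtTwo_badPlaces_ratCast_ne_pair (hR : R = X ^ 2 + C 12 * X + C 18) {ℓ : ℕ} (hℓ : ℓ.Prime)
    (hℓ2 : ℓ ≠ 2) (hℓ3 : ℓ ≠ 3) (v v' w : HeightOneSpectrum (𝓞 (realField R)))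
    (hv : (ℓ : 𝓞 (realField R)) ∈ v.asIdeal) (hv' : (ℓ : 𝓞 (realField R)) ∈ v'.asIdeal) (hne : v ≠ v') (hw : w ≠ v')
    {c : ℚ} (hc : c ≠ 0) :
    badPlaces (c : realField R) (AdjoinRoot.root (realPolyQ R)) ≠ {Sum.inl v, Sum.inl w} := by
  intro h
  have h1 : Sum.inl v ∈ badPlaces (c : realField R) (AdjoinRoot.root (realPolyQ R)) := by
    rw [h]; exact Set.mem_insert _ _
  have h2 := (sqrtNegThreeTimesTwoPlusSqrtTwo_inl_mem_badPlaces_ratCast_iff hR hℓ hℓ2 hℓ3 v v' hv hv' hc).1 h1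
  rw [h, Set.mem_insert_iff, Set.mem_singleton_iff] at h2
  rcases h2 with h2 | h2
  · exact hne (Sum.inl_injective h2).symm
  · exact hw (Sum.inl_injective h2).symm

end IsqrtNegThreeTimesTwoPlusSqrtTwo

end Summit.HodgeConjecture.HodgeConjecture.Ring2.WeilCoverageCM

end
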